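import Literature.Probability.Percolation.StoppingSetDecoupling
import Literature.Probability.Percolation.FiniteEnergy
import HarnessLib

/-!
# Decoupling along a stopping set for BOND percolation (events off the explored edges)

Topic `Literature/Probability/Percolation`; proofs only (no definition, no named fact). The
bond-percolation form of the tree's `StoppingSetDecoupling.lean` (stated there for the site
measure `sitePercolation V p`): the probabilistic step of Kesten's conditioning on the lowest
crossing — "condition on the lowest black left-right crossing `c` … the percolation in the
region above it remains unbiased" (Nolin 2008, proof of Thm. 24 (ii) and §4.4, proof of
Lemma 15 [arXiv 0711.4948: Thm. 23 (ii), Lemma 14]; Kesten 1987, proof of Lemma 2;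
Bollobás–Riordan 2006, Ch. 7, p. 175, stopping sets) — for Bernoulli bond percolation
`bondPercolation G p` on any countable graph. A bond configuration is a set of pairs
(`BondConfig V = Set (Sym2 V)`), so the generic notions `IsStoppingSet` (`ColourSwitching.lean`)
and `dataPiece` (`StoppingSetDecoupling.lean`) apply verbatim with the index type `Sym2 V`; only
the independence input changes (`bondPercolation_real_inter_of_disjoint`, `FiniteEnergy.lean`,
which also asks for measurability — supplied by `DeterminedBy.measurableSet_of_finset`). This is
a bottom-up layer towards `Kesten1987_zdKestenRelation` (`ZdNearCriticalWindow.lean`): the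
five-arm lower bound for bond percolation on `ℤ²` conditions on the region below the lowest
crossing (`dualBelow`, `LowestCrossing.lean`), whose examined edges form a stopping set.

* `bond_real_mem_dataEvent_le` — for a stopping set `N ⊆ G₀` of edges and data-indexed events
  `A F η` determined by finite edge sets disjoint from `F` with `P_p(A F η) ≤ ε`:
  `P_p({ω | ω ∈ A (N ω) (open edges of N ω)}) ≤ ε`;
* `bond_real_mem_dataEvent_eq` — the equality form
  `P_p({ω | ω ∈ A(data ω)}) = Σ_{(F,η)} P_p(data = (F,η)) · P_p(A F η)`;
* `bond_mul_real_mem_dataEvent_le` — the lower decoupling: `P_p(B F η) ≥ c P_p(A F η)` for all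
  data implies `P_p({B(data)}) ≥ c P_p({A(data)})`.
-/

noncomputable section

open MeasureTheory Set

namespace Literature.Probability.Percolation

variable {V : Type*} [Countable V]

open Classical in
/-- **Decoupling along a stopping set, bond percolation.** Let `N` be a stopping set of edges
with `N(ω) ⊆ G₀`, and for all data `(F, η)` let `A F η` be an event determined by a finite set
of pairs disjoint from `F`, of `P_p`-probability at most `ε ≥ 0`. Then
`P_p({ω | ω ∈ A (N ω) (pairs of N ω open in ω)}) ≤ ε` (Nolin: conditionally on the explored
data "percolation there remains unbiased"; "Summing over all possibilities …").
[cite: Nolin2008, §4.4, proof of Lemma 15 (arXiv 0711.4948: Lemma 14)] [cite: KestenScalingCMP1987, proof of Lemma 2] -/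
theorem bond_real_mem_dataEvent_le (Gr : SimpleGraph V) (p : unitInterval) {G₀ : Finset (Sym2 V)}
    {N : Set (Sym2 V) → Finset (Sym2 V)} (hN : IsStoppingSet N) (hNG : ∀ ω, N ω ⊆ G₀)
    (A : Finset (Sym2 V) → Finset (Sym2 V) → Set (BondConfig V))
    (hA : ∀ F η, ∃ H : Finset (Sym2 V), Disjoint F H ∧ DeterminedBy (A F η) ↑H) {ε : ℝ} (hε : 0 ≤ ε)
    (hAε : ∀ F η, (bondPercolation Gr p).real (A F η) ≤ ε) :
    (bondPercolation Gr p).real {ω | ω ∈ A (N ω) ((N ω).filter (· ∈ ω))} ≤ ε := by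
  set μ := bondPercolation Gr p with hμ
  set I : Finset (Finset (Sym2 V) × Finset (Sym2 V)) :=
    (G₀.powerset ×ˢ G₀.powerset).filter fun d => d.2 ⊆ d.1 with hI
  have hcover : {ω : Set (Sym2 V) | ω ∈ A (N ω) ((N ω).filter (· ∈ ω))} ⊆
      ⋃ d ∈ I, dataPiece N d.1 d.2 ∩ A d.1 d.2 := by
    intro ω hω
    have hd : (N ω, (N ω).filter (· ∈ ω)) ∈ I := by
      rw [hI, Finset.mem_filter, Finset.mem_product, Finset.mem_powerset, Finset.mem_powerset]
      exact ⟨⟨hNG ω, (Finset.filter_subset _ _).trans (hNG ω)⟩, Finset.filter_subset _ _⟩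
    refine Set.mem_biUnion hd ⟨⟨rfl, fun v hv => by simp [Finset.mem_filter, hv]⟩, hω⟩
  have hdisj : (↑I : Set (Finset (Sym2 V) × Finset (Sym2 V))).PairwiseDisjoint
      fun d => dataPiece N d.1 d.2 := by
    intro d hd d' hd' hne
    have h1 : d.2 ⊆ d.1 := (Finset.mem_filter.1 (Finset.mem_coe.1 hd)).2
    have h2 : d'.2 ⊆ d'.1 := (Finset.mem_filter.1 (Finset.mem_coe.1 hd')).2
    exact disjoint_dataPiece h1 h2 (by rwa [Prod.mk.eta, Prod.mk.eta])
  have hmeas : ∀ d ∈ I, MeasurableSet (dataPiece N d.1 d.2) := fun d _ =>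
    (determinedBy_dataPiece hN d.1 d.2).measurableSet_of_finset
  have htotal : ∑ d ∈ I, μ.real (dataPiece N d.1 d.2) ≤ 1 := by
    rw [← measureReal_biUnion_finset hdisj hmeas]
    exact (measureReal_mono (subset_univ _) (measure_ne_top _ _)).trans (by rw [probReal_univ])
  have hind : ∀ d ∈ I, μ.real (dataPiece N d.1 d.2 ∩ A d.1 d.2) ≤ μ.real (dataPiece N d.1 d.2) * ε := by
    intro d _
    obtain ⟨H, hFH, hAH⟩ := hA d.1 d.2
    rw [hμ, bondPercolation_real_inter_of_disjoint Gr p (Finset.disjoint_coe.2 hFH)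
      (determinedBy_dataPiece hN d.1 d.2) hAH
      (determinedBy_dataPiece hN d.1 d.2).measurableSet_of_finset hAH.measurableSet_of_finset]
    exact mul_le_mul_of_nonneg_left (hAε d.1 d.2) measureReal_nonneg
  calc μ.real {ω : Set (Sym2 V) | ω ∈ A (N ω) ((N ω).filter (· ∈ ω))}
      ≤ μ.real (⋃ d ∈ I, dataPiece N d.1 d.2 ∩ A d.1 d.2) := measureReal_mono hcover (measure_ne_top _ _)
    _ ≤ ∑ d ∈ I, μ.real (dataPiece N d.1 d.2 ∩ A d.1 d.2) := measureReal_biUnion_finset_le _ _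
    _ ≤ ∑ d ∈ I, μ.real (dataPiece N d.1 d.2) * ε := Finset.sum_le_sum hind
    _ = (∑ d ∈ I, μ.real (dataPiece N d.1 d.2)) * ε := (Finset.sum_mul _ _ _).symm
    _ ≤ 1 * ε := mul_le_mul_of_nonneg_right htotal hε
    _ = ε := one_mul ε

open Classical in
/-- **Equality form of the decoupling, bond percolation**: for a stopping set `N ⊆ G₀` of edges
and data-indexed events `A F η` determined by finite edge sets disjoint from `F`,
`P_p({ω | ω ∈ A (N ω) (open pairs of N ω)}) = Σ_{(F,η)} P_p(data = (F, η)) · P_p(A F η)`.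
[cite: Nolin2008, §4.4, proof of Lemma 15 ("Summing over all possibilities"; arXiv 0711.4948: Lemma 14)] -/
theorem bond_real_mem_dataEvent_eq (Gr : SimpleGraph V) (p : unitInterval) {G₀ : Finset (Sym2 V)}
    {N : Set (Sym2 V) → Finset (Sym2 V)} (hN : IsStoppingSet N) (hNG : ∀ ω, N ω ⊆ G₀)
    (A : Finset (Sym2 V) → Finset (Sym2 V) → Set (BondConfig V))
    (hA : ∀ F η, ∃ H : Finset (Sym2 V), Disjoint F H ∧ DeterminedBy (A F η) ↑H) :
    (bondPercolation Gr p).real {ω | ω ∈ A (N ω) ((N ω).filter (· ∈ ω))} =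
      ∑ d ∈ (G₀.powerset ×ˢ G₀.powerset).filter (fun d => d.2 ⊆ d.1),
        (bondPercolation Gr p).real (dataPiece N d.1 d.2) * (bondPercolation Gr p).real (A d.1 d.2) := by
  set μ := bondPercolation Gr p with hμ
  set I : Finset (Finset (Sym2 V) × Finset (Sym2 V)) :=
    (G₀.powerset ×ˢ G₀.powerset).filter fun d => d.2 ⊆ d.1 with hI
  have hcover : {ω : Set (Sym2 V) | ω ∈ A (N ω) ((N ω).filter (· ∈ ω))} =
      ⋃ d ∈ I, dataPiece N d.1 d.2 ∩ A d.1 d.2 := by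
    ext ω
    constructor
    · intro hω
      have hd : (N ω, (N ω).filter (· ∈ ω)) ∈ I := by
        rw [hI, Finset.mem_filter, Finset.mem_product, Finset.mem_powerset, Finset.mem_powerset]
        exact ⟨⟨hNG ω, (Finset.filter_subset _ _).trans (hNG ω)⟩, Finset.filter_subset _ _⟩
      exact Set.mem_biUnion hd ⟨⟨rfl, fun v hv => by simp [Finset.mem_filter, hv]⟩, hω⟩
    · intro hω
      obtain ⟨d, hd, ⟨hNd, hη⟩, hA'⟩ := Set.mem_iUnion₂.1 hω
      have h1 : N ω = d.1 := hNd
      have h2 : (N ω).filter (· ∈ ω) = d.2 := by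
        have hsub : d.2 ⊆ d.1 := (Finset.mem_filter.1 hd).2
        ext v
        rw [Finset.mem_filter, h1]
        constructor
        · rintro ⟨hv, hvω⟩; exact (hη v hv).1 hvω
        · intro hv; exact ⟨hsub hv, (hη v (hsub hv)).2 hv⟩
      show ω ∈ A (N ω) ((N ω).filter (· ∈ ω))
      rw [h2, h1]; exact hA'
  have hdisj : (↑I : Set (Finset (Sym2 V) × Finset (Sym2 V))).PairwiseDisjoint
      fun d => dataPiece N d.1 d.2 ∩ A d.1 d.2 := by
    intro d hd d' hd' hne
    have h1 : d.2 ⊆ d.1 := (Finset.mem_filter.1 (Finset.mem_coe.1 hd)).2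
    have h2 : d'.2 ⊆ d'.1 := (Finset.mem_filter.1 (Finset.mem_coe.1 hd')).2
    exact (disjoint_dataPiece h1 h2 (by rwa [Prod.mk.eta, Prod.mk.eta])).mono inter_subset_left
      inter_subset_left
  have hmeas : ∀ d ∈ I, MeasurableSet (dataPiece N d.1 d.2 ∩ A d.1 d.2) := fun d _ => by
    obtain ⟨H, -, hAH⟩ := hA d.1 d.2
    exact (determinedBy_dataPiece hN d.1 d.2).measurableSet_of_finset.inter hAH.measurableSet_of_finset
  rw [hcover, measureReal_biUnion_finset hdisj hmeas]
  refine Finset.sum_congr rfl fun d _ => ?_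
  obtain ⟨H, hFH, hAH⟩ := hA d.1 d.2
  rw [hμ, bondPercolation_real_inter_of_disjoint Gr p (Finset.disjoint_coe.2 hFH)
    (determinedBy_dataPiece hN d.1 d.2) hAH
    (determinedBy_dataPiece hN d.1 d.2).measurableSet_of_finset hAH.measurableSet_of_finset]

open Classical in
/-- **Lower decoupling along a stopping set, bond percolation** (the use of "locally monotone"
events given the explored data, Nolin 2008, Lemma 12 [arXiv 0711.4948: Lemma 11], in summed
form): if for every data `(F, η)` the events `A F η` and `B F η` are determined by finite edge
sets disjoint from `F` and `P_p(B F η) ≥ c · P_p(A F η)`, then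
`P_p({ω | ω ∈ B (data ω)}) ≥ c · P_p({ω | ω ∈ A (data ω)})`. [cite: Nolin2008, §4.3 Lemma 12 and §5.2 proof of Thm. 24 (ii) (arXiv 0711.4948: Lemma 11, Thm. 23 (ii))] -/
theorem bond_mul_real_mem_dataEvent_le (Gr : SimpleGraph V) (p : unitInterval) {G₀ : Finset (Sym2 V)}
    {N : Set (Sym2 V) → Finset (Sym2 V)} (hN : IsStoppingSet N) (hNG : ∀ ω, N ω ⊆ G₀)
    (A B : Finset (Sym2 V) → Finset (Sym2 V) → Set (BondConfig V))
    (hA : ∀ F η, ∃ H : Finset (Sym2 V), Disjoint F H ∧ DeterminedBy (A F η) ↑H)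
    (hB : ∀ F η, ∃ H : Finset (Sym2 V), Disjoint F H ∧ DeterminedBy (B F η) ↑H) {c : ℝ}
    (hAB : ∀ F η, c * (bondPercolation Gr p).real (A F η) ≤ (bondPercolation Gr p).real (B F η)) :
    c * (bondPercolation Gr p).real {ω | ω ∈ A (N ω) ((N ω).filter (· ∈ ω))} ≤
      (bondPercolation Gr p).real {ω | ω ∈ B (N ω) ((N ω).filter (· ∈ ω))} := by
  rw [bond_real_mem_dataEvent_eq Gr p hN hNG A hA, bond_real_mem_dataEvent_eq Gr p hN hNG B hB,
    Finset.mul_sum]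
  refine Finset.sum_le_sum fun d _ => ?_
  rw [mul_left_comm]
  exact mul_le_mul_of_nonneg_left (hAB d.1 d.2) measureReal_nonneg

end Literature.Probability.Percolation
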